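import Literature.AnabelianGeometry.EtaleTheta.BiKummerThm44SubModelConnectedOfGaloisCoveringCoset
import Literature.AnabelianGeometry.EtaleTheta.Discharge.Sec4Thm44KummerClassConnected
import Literature.AnabelianGeometry.EtaleTheta.Discharge.Sec4Thm44KummerClassWeak

/-!
# [EtTh] Theorem 4.4 IN FULL — (i) ∧ (ii) ∧ (iii) (saturation ∧ Kummer class) ∧ `N`-th roots — at the genuine connected
# base over the constructed Def 3.3 (iii) data on the small coset model of `D₀` ⇐ {T44-L15b} ONLY (proof-only)

S. Mochizuki, *The étale theta function and its Frobenioid-theoretic manifestations*, Publ. RIMS **45** (2009)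
[MochizukiEtTh2009], §4, Thm 4.4 (i)–(iii), PDF p.94 (printed p.320), proof PDF p.95; [MochizukiFrdII2008] Def 2.1 (ii)
p.17 (Kummer class).  abc-iut cell, layer L2, plan/L2/SUBDAG-EtTh-Thm44.md (custodian lineage abc-iut-w5-d179), cone
nodes `EtTh:Thm4.4(i)`, `EtTh:Thm4.4(ii)`, `EtTh:Thm4.4(iii)` + sub-DAG row T44-L16.  Seat abc-iut-w5-d179 (gen 5).
PROOF-ONLY (0 `def`s, no `Prop` facts, no instances); sequel of `BiKummerThm44SubModelConnectedOfGaloisCoveringCoset.lean`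
(§0 `hBinj` theorems over `DivisorMonoids.ofGaloisActionCoset`); abc-iut-L2-t3's `thm44_full_mkOfConnectedTemperoid_of_hBinj`
(`Sec4Thm44KummerClassConnected.lean`, p439173 / p439960) and abc-iut-L6-t12's weak twin
`thm44_full_mkOfConnectedTemperoid_of_hBinj_treeVocabWeak` (`Sec4Thm44KummerClassWeak.lean`, W11) are consumed BY NAME
(both pinned at `K, Π^tp_X, D₀ : Type 0`, monoids at universe `0` — Mathlib `groupCohomology`), which is exactly what the
coset model (`D₀ = InducedCategory (Action (Type 0) G) (H ↦ G/H) : Type 0`) makes available.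

* §3 strong `Λ = ℤ` coset data (`ofRlfZ … hpf`): **Thm 4.4 IN FULL ⇐ {T44-L15b}** beyond the constructor parameter `hpf`;
* §4 WEAK `Λ = ℤ` coset data: **Thm 4.4 IN FULL ⇐ {T44-L15b} ONLY — no structural binder, no constructor parameter, no
  plan/FACT-LIST fact**; binder census of `EtTh:Thm4.4(i)(ii)(iii)` + T44-L16 at the constructed data = {T44-L15b} =
  {`hNH`, `hIso`} at the faithful [FrdII] Def 2.2 (ii) reading (`BiKummerThm44SubNHSatDef22.lean`).

HONEST FRAMING: refereed pre-IUT material; every theorem is an implication for data so parametrised (`LogDivisorModel` /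
`GaloisAction` / `CuspLaws` are interface and parameter records — nothing asserts they arise from an actual curve; NV of
the quantified class of tempered Frobenioids over constructed data is abc-iut-w6-d048's finding F-w6d048g3-1 / row in
flight); one term of the Def 3.3 (iii) limit (Rmk 3.3.1); weak vocabulary = the reading of record (plan/FACT-LIST
F-L2d2-1); nothing here bears on the disputed [IUTchIII] Cor. 3.12; typed ≠ proved — here PROVED (kernel compositions).
-/

noncomputable section

namespace Literature.AnabelianGeometry.EtaleTheta

open CategoryTheory Opposite Function Literature.AlgebraicGeometry.Frobenioids Literature.AnabelianGeometry.SemiGraphs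

namespace BiKummerSetting

open LogDivisorModel.GaloisAction

/-! ### §3 [EtTh] Thm 4.4 IN FULL (with the Kummer-class clause of (iii)) over the coset data, universe `0` -/

section Full

variable {Z₁ : LogDivisorModel.{0}} {G₁ : Type} [Group G₁] (GA₁ : Z₁.GaloisAction G₁) (hC₁ : Z₁.CuspLaws)
  (hpf₁ : ∀ Y : (InducedCategory (Action (Type 0) G₁) (cosetGSet G₁))ᵒᵖ,
    IsPerfFactorial ((DivisorMonoids.ofGaloisActionCoset GA₁ hC₁).Φ₀.obj Y))
  {Z₂ : LogDivisorModel.{0}} {G₂ : Type} [Group G₂] (GA₂ : Z₂.GaloisAction G₂) (hC₂ : Z₂.CuspLaws)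
  (hpf₂ : ∀ Y : (InducedCategory (Action (Type 0) G₂) (cosetGSet G₂))ᵒᵖ,
    IsPerfFactorial ((DivisorMonoids.ofGaloisActionCoset GA₂ hC₂).Φ₀.obj Y))
  {K : Type} [Field K] {K' : Type} [Field K'] {X₁ : SemiGraphs.TemperedArithmeticGroup.{0} K}
  {X₂ : SemiGraphs.TemperedArithmeticGroup.{0} K'}
  {IsRational₁ IsStrictlyRational₁ : ((ConnectedPart (BTemp X₁.Pi))ᵒᵖ ⥤ CommMonCat.{0}) → Prop}
  {IsRational₂ IsStrictlyRational₂ : ((ConnectedPart (BTemp X₂.Pi))ᵒᵖ ⥤ CommMonCat.{0}) → Prop}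
  {tf₁ : TemperedFrobenioid (RealifiedDivisorMonoids.ofRlfZ (DivisorMonoids.ofGaloisActionCoset GA₁ hC₁) hpf₁)
    (ConnectedPart (BTemp X₁.Pi)) (treeCatVocab (ConnectedPart (BTemp X₁.Pi)) IsRational₁ IsStrictlyRational₁)}
  {hZ₁ : tf₁.monoidType = MonoidType.Z} {hP₁ : ∀ A : (ConnectedPart (BTemp X₁.Pi))ᵒᵖ, IsPerfect (tf₁.Φ.carrier A)}
  {NH₁ : Subgroup (Field.absoluteGaloisGroup K) → tf₁.category → ℕ+ → Prop} {A₁ : tf₁.category}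
  {hA₁ : PreFrobenioid.IsFrobeniusTrivial tf₁.toElem A₁} {hA₁' : SemiGraphs.IsGaloisObj A₁.base.obj}
  {tf₂ : TemperedFrobenioid (RealifiedDivisorMonoids.ofRlfZ (DivisorMonoids.ofGaloisActionCoset GA₂ hC₂) hpf₂)
    (ConnectedPart (BTemp X₂.Pi)) (treeCatVocab (ConnectedPart (BTemp X₂.Pi)) IsRational₂ IsStrictlyRational₂)}
  {hZ₂ : tf₂.monoidType = MonoidType.Z} {hP₂ : ∀ B : (ConnectedPart (BTemp X₂.Pi))ᵒᵖ, IsPerfect (tf₂.Φ.carrier B)}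
  {NH₂ : Subgroup (Field.absoluteGaloisGroup K') → tf₂.category → ℕ+ → Prop} {A₂ : tf₂.category}
  {hA₂ : PreFrobenioid.IsFrobeniusTrivial tf₂.toElem A₂} {hA₂' : SemiGraphs.IsGaloisObj A₂.base.obj}

/-- **[EtTh] Theorem 4.4 (i) ∧ (ii) ∧ (iii) IN FULL (saturation ∧ Kummer class) ∧ (`N`-th roots) at the genuine
connected base `B^temp(Π^tp_X)⁰` over the strong `Λ = ℤ` data of the coset model ⇐ {T44-L15b} ONLY** (beyond the
constructor parameters `hpf₁` / `hpf₂`): abc-iut-L2-t3's `thm44_full_mkOfConnectedTemperoid_of_hBinj` (p439960; Kummer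
class = [FrdII] Def 2.1 (ii), T44-L16) with BOTH `hBinj` binders DISCHARGED by §0.  Binder census of the three cone nodes
+ T44-L16 at these data: {T44-L15b}. [cite: MochizukiEtTh2009, Thm 4.4 p.94] -/
theorem Thm44Hyp.thm44_full_mkOfConnectedTemperoid_ofGaloisActionCoset
    (h : Thm44Hyp (mkOfConnectedTemperoid X₁ tf₁ hZ₁ hP₁ NH₁ A₁ hA₁ hA₁')
      (mkOfConnectedTemperoid X₂ tf₂ hZ₂ hP₂ NH₂ A₂ hA₂ hA₂'))
    (hF₁ : PreFrobenioid.IsFrobenioid tf₁.toElem) (hF₂ : PreFrobenioid.IsFrobenioid tf₂.toElem)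
    (h3 : h.PreservesFrobeniusStructure) (h15 : h.PreservesNHSaturatedBsFld) :
    Thm44_i h ∧ Thm44_ii h (h.psiModel hF₁ hF₂ h3) ∧ Thm44_iii h (h.psiModel hF₁ hF₂ h3) ∧
      h.PreservesKummerClass (h.psiModel hF₁ hF₂ h3)
        (h.galoisCompatible_mkOfConnectedTemperoid _ _ _ _ _ _ _ _ _ _ _ _ _ _)
        (h.biratCompatible_mkOfModel hF₁ hF₂ h3) ∧
      h.PreservesNthRoots (h.psiModel hF₁ hF₂ h3) (fun φ f => tf₁.pullFracModel φ f)
        (fun φ f => tf₂.pullFracModel φ f) :=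
  h.thm44_full_mkOfConnectedTemperoid_of_hBinj hF₁ hF₂ h3
    (DivisorMonoids.ofGaloisActionCoset_ofRlfZ_hBinj GA₁ hC₁ hpf₁)
    (DivisorMonoids.ofGaloisActionCoset_ofRlfZ_hBinj GA₂ hC₂ hpf₂) h15

/-- **The same with every ψ-slot proof supplied by the tree** — Thm 4.4 IN FULL over the strong coset data, literally
⇐ {T44-L15b} beyond `hpf₁` / `hpf₂`. [cite: MochizukiEtTh2009, Thm 4.4 p.94] -/
theorem Thm44Hyp.thm44_full_mkOfConnectedTemperoid_ofGaloisActionCoset'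
    (h : Thm44Hyp (mkOfConnectedTemperoid X₁ tf₁ hZ₁ hP₁ NH₁ A₁ hA₁ hA₁')
      (mkOfConnectedTemperoid X₂ tf₂ hZ₂ hP₂ NH₂ A₂ hA₂ hA₂')) (h15 : h.PreservesNHSaturatedBsFld) :
    Thm44_i h ∧
      Thm44_ii h (h.psiModel (isFrobenioid_ofGaloisActionCoset GA₁ hC₁ hpf₁)
        (isFrobenioid_ofGaloisActionCoset GA₂ hC₂ hpf₂)
        (h.preservesFrobeniusStructure_mkOfConnectedTemperoid_ofGaloisActionCoset GA₁ hC₁ hpf₁ GA₂ hC₂ hpf₂)) ∧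
      Thm44_iii h (h.psiModel (isFrobenioid_ofGaloisActionCoset GA₁ hC₁ hpf₁)
        (isFrobenioid_ofGaloisActionCoset GA₂ hC₂ hpf₂)
        (h.preservesFrobeniusStructure_mkOfConnectedTemperoid_ofGaloisActionCoset GA₁ hC₁ hpf₁ GA₂ hC₂ hpf₂)) ∧
      h.PreservesKummerClass (h.psiModel (isFrobenioid_ofGaloisActionCoset GA₁ hC₁ hpf₁)
        (isFrobenioid_ofGaloisActionCoset GA₂ hC₂ hpf₂)
        (h.preservesFrobeniusStructure_mkOfConnectedTemperoid_ofGaloisActionCoset GA₁ hC₁ hpf₁ GA₂ hC₂ hpf₂))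
        (h.galoisCompatible_mkOfConnectedTemperoid _ _ _ _ _ _ _ _ _ _ _ _ _ _)
        (h.biratCompatible_mkOfModel (isFrobenioid_ofGaloisActionCoset GA₁ hC₁ hpf₁)
          (isFrobenioid_ofGaloisActionCoset GA₂ hC₂ hpf₂)
          (h.preservesFrobeniusStructure_mkOfConnectedTemperoid_ofGaloisActionCoset GA₁ hC₁ hpf₁ GA₂ hC₂ hpf₂)) ∧
      h.PreservesNthRoots (h.psiModel (isFrobenioid_ofGaloisActionCoset GA₁ hC₁ hpf₁)
        (isFrobenioid_ofGaloisActionCoset GA₂ hC₂ hpf₂)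
        (h.preservesFrobeniusStructure_mkOfConnectedTemperoid_ofGaloisActionCoset GA₁ hC₁ hpf₁ GA₂ hC₂ hpf₂))
        (fun φ f => tf₁.pullFracModel φ f) (fun φ f => tf₂.pullFracModel φ f) :=
  h.thm44_full_mkOfConnectedTemperoid_ofGaloisActionCoset GA₁ hC₁ hpf₁ GA₂ hC₂ hpf₂ _ _ _ h15

end Full

/-! ### §4 [EtTh] Thm 4.4 IN FULL over the WEAK coset data, universe `0` — ⇐ {T44-L15b} and nothing else -/

section FullWeak

variable {Z₁ : LogDivisorModel.{0}} {G₁ : Type} [Group G₁] (GA₁ : Z₁.GaloisAction G₁) (hC₁ : Z₁.CuspLaws)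
  {Z₂ : LogDivisorModel.{0}} {G₂ : Type} [Group G₂] (GA₂ : Z₂.GaloisAction G₂) (hC₂ : Z₂.CuspLaws)
  {K : Type} [Field K] {K' : Type} [Field K'] {X₁ : SemiGraphs.TemperedArithmeticGroup.{0} K}
  {X₂ : SemiGraphs.TemperedArithmeticGroup.{0} K'}
  {IsRational₁ IsStrictlyRational₁ : ((ConnectedPart (BTemp X₁.Pi))ᵒᵖ ⥤ CommMonCat.{0}) → Prop}
  {IsRational₂ IsStrictlyRational₂ : ((ConnectedPart (BTemp X₂.Pi))ᵒᵖ ⥤ CommMonCat.{0}) → Prop}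
  {tf₁ : TemperedFrobenioid
    (RealifiedDivisorMonoids.ofRlfZWeak (DivisorMonoids.ofGaloisActionCoset GA₁ hC₁)
      (DivisorMonoids.ofGaloisActionCoset_isPerfFactorialCof GA₁ hC₁))
    (ConnectedPart (BTemp X₁.Pi)) (treeCatVocab (ConnectedPart (BTemp X₁.Pi)) IsRational₁ IsStrictlyRational₁)}
  {hZ₁ : tf₁.monoidType = MonoidType.Z} {hP₁ : ∀ A : (ConnectedPart (BTemp X₁.Pi))ᵒᵖ, IsPerfect (tf₁.Φ.carrier A)}
  {NH₁ : Subgroup (Field.absoluteGaloisGroup K) → tf₁.category → ℕ+ → Prop} {A₁ : tf₁.category}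
  {hA₁ : PreFrobenioid.IsFrobeniusTrivial tf₁.toElem A₁} {hA₁' : SemiGraphs.IsGaloisObj A₁.base.obj}
  {tf₂ : TemperedFrobenioid
    (RealifiedDivisorMonoids.ofRlfZWeak (DivisorMonoids.ofGaloisActionCoset GA₂ hC₂)
      (DivisorMonoids.ofGaloisActionCoset_isPerfFactorialCof GA₂ hC₂))
    (ConnectedPart (BTemp X₂.Pi)) (treeCatVocab (ConnectedPart (BTemp X₂.Pi)) IsRational₂ IsStrictlyRational₂)}
  {hZ₂ : tf₂.monoidType = MonoidType.Z} {hP₂ : ∀ B : (ConnectedPart (BTemp X₂.Pi))ᵒᵖ, IsPerfect (tf₂.Φ.carrier B)}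
  {NH₂ : Subgroup (Field.absoluteGaloisGroup K') → tf₂.category → ℕ+ → Prop} {A₂ : tf₂.category}
  {hA₂ : PreFrobenioid.IsFrobeniusTrivial tf₂.toElem A₂} {hA₂' : SemiGraphs.IsGaloisObj A₂.base.obj}

/-- **[EtTh] Theorem 4.4 (i) ∧ (ii) ∧ (iii) IN FULL (saturation ∧ Kummer class) ∧ (`N`-th roots) at the genuine
connected base `B^temp(Π^tp_X)⁰` over the WEAK `Λ = ℤ` data of the coset model ⇐ {T44-L15b} ONLY — no structural
binder, no constructor parameter, no plan/FACT-LIST fact** (`ψ = psiModel hF₁ hF₂ h3`, any proofs): abc-iut-L6-t12's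
`thm44_full_mkOfConnectedTemperoid_of_hBinj_treeVocabWeak` (W11) with both `hBinj` binders DISCHARGED by §0 and the weak
Prop 3.4 (i) slot PROVED (`ofGaloisActionCoset_isPerfFactorialCof`). [cite: MochizukiEtTh2009, Thm 4.4 p.94] -/
theorem Thm44Hyp.thm44_full_mkOfConnectedTemperoid_ofGaloisActionCoset_treeVocabWeak
    (h : Thm44Hyp (mkOfConnectedTemperoid X₁ tf₁ hZ₁ hP₁ NH₁ A₁ hA₁ hA₁')
      (mkOfConnectedTemperoid X₂ tf₂ hZ₂ hP₂ NH₂ A₂ hA₂ hA₂'))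
    (hF₁ : PreFrobenioid.IsFrobenioid tf₁.toElem) (hF₂ : PreFrobenioid.IsFrobenioid tf₂.toElem)
    (h3 : Thm44Hyp.PreservesFrobeniusStructure (V := treeMonoidVocabWeak.{0}) h)
    (h15 : h.PreservesNHSaturatedBsFld) :
    Thm44_i h ∧ Thm44_ii h (h.psiModel hF₁ hF₂ h3) ∧ Thm44_iii h (h.psiModel hF₁ hF₂ h3) ∧
      h.PreservesKummerClass (h.psiModel hF₁ hF₂ h3)
        (h.galoisCompatible_mkOfConnectedTemperoid _ _ _ _ _ _ _ _ _ _ _ _ _ _)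
        (h.biratCompatible_mkOfModel hF₁ hF₂ h3) ∧
      h.PreservesNthRoots (h.psiModel hF₁ hF₂ h3) (fun φ f => tf₁.pullFracModel φ f)
        (fun φ f => tf₂.pullFracModel φ f) :=
  h.thm44_full_mkOfConnectedTemperoid_of_hBinj_treeVocabWeak hF₁ hF₂ h3
    (DivisorMonoids.ofGaloisActionCoset_ofRlfZWeak_hBinj GA₁ hC₁ _)
    (DivisorMonoids.ofGaloisActionCoset_ofRlfZWeak_hBinj GA₂ hC₂ _) h15

/-- **The same with every ψ-slot proof supplied by the tree** — Thm 4.4 IN FULL over the weak coset data, LITERALLY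
⇐ {T44-L15b}. [cite: MochizukiEtTh2009, Thm 4.4 p.94] -/
theorem Thm44Hyp.thm44_full_mkOfConnectedTemperoid_ofGaloisActionCoset_treeVocabWeak'
    (h : Thm44Hyp (mkOfConnectedTemperoid X₁ tf₁ hZ₁ hP₁ NH₁ A₁ hA₁ hA₁')
      (mkOfConnectedTemperoid X₂ tf₂ hZ₂ hP₂ NH₂ A₂ hA₂ hA₂')) (h15 : h.PreservesNHSaturatedBsFld) :
    Thm44_i h ∧
      Thm44_ii h (h.psiModel (isFrobenioid_ofGaloisActionCoset_treeVocabWeak GA₁ hC₁)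
        (isFrobenioid_ofGaloisActionCoset_treeVocabWeak GA₂ hC₂)
        (h.preservesFrobeniusStructure_mkOfConnectedTemperoid_ofGaloisActionCoset_treeVocabWeak GA₁ hC₁ GA₂ hC₂)) ∧
      Thm44_iii h (h.psiModel (isFrobenioid_ofGaloisActionCoset_treeVocabWeak GA₁ hC₁)
        (isFrobenioid_ofGaloisActionCoset_treeVocabWeak GA₂ hC₂)
        (h.preservesFrobeniusStructure_mkOfConnectedTemperoid_ofGaloisActionCoset_treeVocabWeak GA₁ hC₁ GA₂ hC₂)) ∧
      h.PreservesKummerClass (h.psiModel (isFrobenioid_ofGaloisActionCoset_treeVocabWeak GA₁ hC₁)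
        (isFrobenioid_ofGaloisActionCoset_treeVocabWeak GA₂ hC₂)
        (h.preservesFrobeniusStructure_mkOfConnectedTemperoid_ofGaloisActionCoset_treeVocabWeak GA₁ hC₁ GA₂ hC₂))
        (h.galoisCompatible_mkOfConnectedTemperoid _ _ _ _ _ _ _ _ _ _ _ _ _ _)
        (h.biratCompatible_mkOfModel (isFrobenioid_ofGaloisActionCoset_treeVocabWeak GA₁ hC₁)
          (isFrobenioid_ofGaloisActionCoset_treeVocabWeak GA₂ hC₂)
          (h.preservesFrobeniusStructure_mkOfConnectedTemperoid_ofGaloisActionCoset_treeVocabWeak GA₁ hC₁ GA₂ hC₂)) ∧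
      h.PreservesNthRoots (h.psiModel (isFrobenioid_ofGaloisActionCoset_treeVocabWeak GA₁ hC₁)
        (isFrobenioid_ofGaloisActionCoset_treeVocabWeak GA₂ hC₂)
        (h.preservesFrobeniusStructure_mkOfConnectedTemperoid_ofGaloisActionCoset_treeVocabWeak GA₁ hC₁ GA₂ hC₂))
        (fun φ f => tf₁.pullFracModel φ f) (fun φ f => tf₂.pullFracModel φ f) :=
  h.thm44_full_mkOfConnectedTemperoid_ofGaloisActionCoset_treeVocabWeak GA₁ hC₁ GA₂ hC₂ _ _ _ h15

end FullWeak

end BiKummerSetting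

end Literature.AnabelianGeometry.EtaleTheta

end
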